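import Literature.NumberTheory.LFunctions.Zhang2022.KnifeEdgeNuInvisiblePsiOne
import Literature.NumberTheory.LFunctions.Zhang2022.KnifeEdgeMuPsiThreshold
import Literature.NumberTheory.LFunctions.Zhang2022.RepairBlenLambda

/-!
# Zhang (2022) §18-margin repair rung, programme F-S3 §E (cell landau-siegel, barrier extension, stub S-E-bt2-1;
# 𝒟_len intake rows (L-b)∣μψ and (L-b)∣νψ): the `R⁺⁺` families «μψ one-sided whole profile on `[0, b]`, `b > 1`»
# (`familyMuPsiOverhang C M`, `familyMuPsiOverhangAll`) and «νψ = (1∗χ)ψ overhang piece on `[1, θ]`, `θ > 1`»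
# (`familyNuOverhang c' S`, `familyNuOverhangAll`) — the §E wraps of registry rows E-072/E-073 and E-074′

Y. Zhang, *Discrete mean estimates and the Landau–Siegel zero*, arXiv:2211.02515v1 [Zhang2022LandauSiegel] —
an unrefereed manuscript under adjudication. **WHAT THIS IS NOT: not a claim about Theorems 1–2 of
arXiv:2211.02515, about Landau–Siegel zeros, about a repaired `Margin232`, or about Parity; nothing here asserts
any claim of the manuscript or any estimate. The programme SEARCHES and TYPES; no claim until a kernel theorem
says so.** The §E WRAPS of the B-len typers' class-slot modules `KnifeEdgeMuPsiOverhang` (p458584: the one-sided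
μψ dictionary `MuPsiDict c' b S M X` with slots scale `S`, diagonal `M` (E-072), off-diagonal `X` (E-073), the
decision `MuPsiCloses`, the priced robust currency `OneSidedBounded` / `RobustMuPsiMargin` /
`not_robustMuPsiMargin_of_nonneg`), its threshold companion `KnifeEdgeMuPsiThreshold` (p465279, ls-barrier-p2:
`robustMuPsiClosing_iff_robustMargin` = T-μψ-2, tightness `muPsiCloses_topDiagForm_zero`), and `KnifeEdgeNuOverhang`
(p461177: the νψ dictionary `NuDict`, the ruling `NuMeanInvisible` (E-074′, derivation S) with its kernel
consequences `nuDict_zero_of_meanInvisible`, `not_nuCloses_of_invisible`, `mainTerm_add_nuPiece`) — into the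
extension protocol of `RepairRplus` (p455670), in the shape of `Repair.familyLambdaOverhangAll` (RepairBlenLambda,
p467353, the (L-b)∣Λ row) and `Repair.familyFarBV` (no-slot-in-class rows). Nothing of those modules is re-typed.

**C1 — the class (KILL word of record).** B-len was KILLED: of-record line ls-lead, cell STATUS 2026-08-26T19:19:33Z,
under director-frontier pre-authorisation 18:53:49Z («§B-len KILL — OF RECORD … KILL-draft v2.4 b46628540b6b957c §1
«KILL(B-len) INSIDE 𝒟_len GIVEN B-AH (E-014)» with the E-085 (c)-door cited … candidates 0 of 189, no number
load-bearing … family B-len DIES INTO §E»); countersignature ls-B-ref-1 (REF-B1) 19:15:24Z over v2.3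
23f7f953463b7ce2, covering v2.4 (§2 class block unchanged); intake of record `Repair.blenWord` / `familyBlen`
(RepairIntakeBlen p465008; (L-b) declared partial → `blenWord2`). PREMISE OF THE WORD, BY NAME: «GIVEN B-AH (E-014,
GLOBAL form — exact Cauchy–Schwarz / positivity persists in the completed ⟨A⟩-world calculus of the class)». **The
family theorems below do not use B-AH; it is the premise for reading the displayed slots as (A)-world properties**
(μψ: the sign slot `MuPsiDiagNonneg` is the (2.16)-reading «the class diagonal is a sum of squares», and the
exclusion of a sign-violating `X_μ` is exactly what E-073 prices; νψ: the slot is the derivation's ruling E-074′, not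
B-AH); the (c)-door is registry row E-085 «non-model main-order entry» (open, used in no word). The sub-class text,
VERBATIM (B-len/KILL-draft.md v2.4 §2, the (L-b) conjunct): «(L-b) arithmetic coefficient classes on an OVERHANG piece
[1, θ] (or whole profile [0, θ]) glued to an in-class bulk: … μψ one-sided whole-profile g on [0, b], b ∈ (1,2)
(rows E-072/E-073); νψ = (1∗χ)ψ·v(z_n) and its variants ν·log n, ν∗(smooth), (1∗χ)(P_j/n)^β (S3; row E-074′ —
invisible-(A)); [general bounded a(n), |a(n)| ≤ 1, arbitrary beyond P: STATEMENT ONLY (E-032 top > 1 half) =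
n-len-1]», inside the common box «… of which AT LEAST ONE has top θ ∈ (1, 2) … endgame ∈ {POS (fixed amplitudes),
CS (free ι)} … family = Zhang's PRIME family ψ mod p, p ∼ P», and the two clauses of the KILL sentence (§1,
verbatim): «(μψ one-sided) the same SIGN/PSD statement for X_μ (E-073, XL-substantive) — because M ≥ 0 ⇒
`not_robustMuPsiMargin_of_nonneg` (p458584)» and «(νψ = (1∗χ)ψ) NOTHING can make it close: the class is
invisible-(A) at main order (E-074′ `NuPieceInvisible`, derivation S verdict-inert, ls-theory RULING 17:33:45Z:
TRUE(u ⊕ v_ν) = TRUE(u) = 𝔅(u) ≥ 0)». Members of record (DESIGN-MAP-len.md v0.8 466a1df1b6d1231c): μψ — the 18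
rows `len-mu-{zhang,quad,plateau}-th*` of B-len/designs/BATCH-2.json c57eb04c297a400f = ONE-SIDED whole profiles on
`[0, θ]`, `θ ∈ {21/20, 11/10, 5/4}` (+ companions `81/80, 41/40, 17/16`): `g(z) = 1 − z/θ` (Zhang's own),
`(1 − z/θ)²`, the plateau `1` on `[0,1]`, `(θ − z)/(θ − 1)` on `[1,θ]`; νψ — the 48 rows
`len-nu-{bump,front,back,rampcut}-u{52,32}-th*` of BATCH-1v2.json c516b3bb5a4103db = bulk `ϰ(1,k)` ⊕ a POLYNOMIAL
ν-profile on `[1,θ]` (bump `4t(1−t)`, two cubics, the cut ramp `t` with a jump at `θ`; `t = (z−1)/(θ−1)`), the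
same profile tables as the `len-lam-*` rows.

Lean classes. μψ: `Repair.MuPsiDesign.InClass` = `1 < b` ∧ `Repair.OneSidedProfile b g g′` (p458584's binder
verbatim: continuous on `[0,b]`, marked right derivative on `(0,b)`, `g(b) = 0`; the WALL VALUE `g(1)` is free).
νψ: `Repair.NuDesign.InClass` = `1 < θ` ∧ `KnifeEdge.bvOverhang θ v v′` (the ruling's profile class verbatim: bounded
variation on `[1,θ]`, sup-bounded, `v = 0` off `[1,θ]`; jumps allowed). DECLARED DIFFERENCES (none silent): (i) WIDER
— any `b > 1` / `θ > 1` (the word: `∈ (1,2)`; knots `≤ 5/4` evaluated = narrowing n-len-3, carried, not claimed as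
numerics); μψ any one-sided profile (the word: PPE(ℚ[i]) — Zhang's `1 − z/θ`, the square and the plateau are members
by term, Part 3); νψ any BV profile (every polynomial piece on `[1,θ]` is a member, `bvOverhang_polyProf`); (ii) νψ
NARROWER, uncovered part listed — the word's VARIANTS «ν·log n, ν∗(smooth), (1∗χ)(P_j/n)^β» are NOT members: the
typed piece is `KnifeEdge.nuPoly` with the plain coefficient `ν = 1∗χ` (`Skeleton.nu`) only, and `NuMeanInvisible` is
stated for it alone; the variants are an UNCOVERED SUB-WORD of (L-b)∣νψ (statement only; no design of record has a
variant coefficient — all 48 `len-nu-*` rows are plain `νψ·v(z_n)`), to be carried beside u1–u5 in `blenWord2`;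
(iii) the νψ design is the ν-PIECE (θ, v, v′) — the bulk it is glued to is ARBITRARY (the verdict quantifies over
every design polynomial family `F`), so the 48 rows are covered piece-wise whatever the bulk; the LIPSCHITZ sub-class
`KnifeEdge.lipOverhang θ` (⊆ `bvOverhang θ`: `KnifeEdge.bvOverhang_of_lipOverhang`, p468144 — ls-Blen-typer-2 g2's
E-074′ KERNEL THEOREM `norm_nuPoly_le_of_psiOne` / `abs_discMean_add_nuPoly_sub_le_of_prop22i` on `Ψ₁`) EMBEDS into
this family by term (`NuDesign.inClass_of_lipOverhang`, C2) and is DECIDED BY THEOREM in the relative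
(E-003/`familyFarPiece`) currency with NO slot by the separate row S-E-bt2-2 `RepairBlenNuLipschitz`
(`Repair.familyNuLipOverhangAll`, ls-Blen-typer-2 g2) — split of record (ls-Blen-plan 21:15:32Z): the 36 continuous
`len-nu-{bump,front,back}-*` rows are decided there unconditionally, the 12 `len-nu-rampcut-*` JUMP rows are members
of THIS conditional row only (coverage counted once per row, stronger currency wins); (iv) the Λχψ clause is
`RepairBlenLambda` (p467353), not this file; the narrowings n-len-1 (general bounded `a(n)` = STATEMENT ONLY — no
family may claim it), n-len-2, n-len-3 are carried verbatim and NOT claimed.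

| family (this file) | sub-class of 𝒟_len | currency | displayed slots (WORLD binders, kind (c)) | flag |
|---|---|---|---|---|
| `familyMuPsiOverhangAll` (+ per-world `familyMuPsiOverhang C M`) | (L-b)∣μψ, one-sided `[0,b]`, b > 1 | MODEL, ROBUST price currency of E-073 (worlds `(C, M)`: price level `C ≥ 0` = the size of a `C`-bounded off-diagonal input `OneSidedBounded b C X`, diagonal functional `M` = E-072) | `MuPsiDiagNonneg b M` («M ≥ 0 on one-sided profiles of length b», E-072 sign, derivation S/M: shape typed, functional NOT derived — candidate `sqfreeDiagMass` PROVED ≥ 0) | CONDITIONAL-ROBUST «GIVEN the E-072 sign» (B-AH reading: the completed class functional is a sum of squares); for the CANDIDATE diagonal the row is DECIDED (`familyMuPsiOverhangAll_verdict_sqfree`); threshold T-μψ-2 `robustMuPsiClosing_iff_robustMargin` (p465279); x2 = where E-032-class / E-073 input would enter (below) |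
| `familyNuOverhangAll` (+ per-world `familyNuOverhang c' S`) | (L-b)∣νψ, plain `ν = 1∗χ`, overhang `[1,θ]`, θ > 1, BV profile | X-WORLD / discrete mean (invisibility): dictionary of record `(M, X) = (0, 0)` and the main constant of ANY design is unchanged by the piece | `NuMeanInvisible c' θ (bvOverhang θ) S` (E-074′, derivation S, verdict-inert) + the manuscript's `Prop22i`, `Lemma23 c'` and `ScaleEventuallyPos S` as binders (kind (b)) | CONDITIONAL on the analytic slot E-074′ = DECIDED-GIVEN-SLOT (`familyNuOverhangAll_decided` decides the IMPLICATION slot ⇒ verdict; shape of `familyFarPiece`: the slot is a derivation-backed estimate, not B-AH; on the Lipschitz sub-class the slot is a theorem, p468144/p470276); variants UNCOVERED (declared) |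

**x2 — where E-032-class / E-073 input would enter** (ls-barrier-p2, HOME/barrier/p2/MUPSI-X2.md v1 8ac2977471d97ca7
§2, folded verbatim): T-μψ-1 «MuPsiCloses b M X ⟺ ∃ one-sided g with Re X_μ(g,g) < −M(g): input = E-073 with the
lowering sign exceeding E-072's diagonal» (`KnifeEdge.muPsiCloses_iff_exists_offDiag_lt`); T-μψ-2 «(∀ X,
OneSidedBounded b C X → MuPsiCloses b M X) ⟺ RobustMuPsiMargin b C M; with M ≥ 0 no robust closing
(not_robustMuPsiMargin_of_nonneg) — your familyMuPsiOverhang row is this CONDITIONAL-ROBUST sentence, not coverage of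
x2» (`KnifeEdge.robustMuPsiClosing_iff_robustMargin`, `not_robustMuPsiClosing_of_nonneg`,
`exists_bounded_world_not_closing`); T-μψ-3 «scale slot S χ-free, 𝔞 lost; endgame theorem1_of_muPsiDict needs
ScaleEventuallyPos S + MuPsiDict + Prop22i + Lemma23» (`KnifeEdge.theorem1_of_muPsiDict`). «Only the SIGN decides»
for μψ (the word's §1): `Cstar = 0` ⟸ `KnifeEdge.oneSidedBounded_zero` + `not_muPsiCloses_of_nonneg`; the robust
margin never exists for `M ≥ 0`, `C ≥ 0` (`not_robustMuPsiMargin_of_nonneg`) — theorems, never folded into the class;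
the per-design required strengths of DESIGN-MAP-len v0.8 are DATA, no number enters a statement.

**Contents.** Part 1 — the μψ row: slot `MuPsiDiagNonneg` (inhabited: `muPsiDiagNonneg_sqfreeDiagMass`,
`muPsiDiagNonneg_zero`), `MuPsiDesign` / `.InClass`, per-world `familyMuPsiOverhang C M` (Verdict `0 ≤ C →
MuPsiDiagNonneg d.b M → ¬ (M g g′ + C·N_b(g)² < 0)`: the member is no robust-margin witness) + `_decided` +
`rplus_muPsiOverhang_decided`, the CLOSED term `familyMuPsiOverhangAll` (worlds `(C, M)` as binders) + `_iff` +
`_decided` + `rplus_muPsiOverhangAll_decided` + unbundled `not_repairable_muPsiOverhang`, the class-level reading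
`familyMuPsiOverhangAll_decided_iff_not_robustMargin` (decided ⟺ `∀ b > 1, C ≥ 0, M, MuPsiDiagNonneg b M →
¬ RobustMuPsiMargin b C M` = p458584's sentence) and `familyMuPsiOverhangAll_not_robustClosing` (via T-μψ-2: no
robust closing), per-top exactness `muPsi_null_iff_not_robustMargin`; C3(c′): the sign slot is load-bearing BY TERM —
the continued χψ diagonal `M := Re 𝔅_b` violates it and carries a robust margin at `C = 0` on a class member at every
`b > 1` (`robustMuPsiMargin_topDiagForm`, `muPsiDiag_slot_loadBearing`, from p465279's `muPsiCloses_topDiagForm_zero` /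
`Repair.topForm_indefinite`); the price level `0 ≤ C` is part of the currency, not an analytic slot. Part 2 — the νψ
row: `HasMainConstant c' S F m` (the main-constant predicate of `mainTerm_add_nuPiece`, named), `NuDesign` /
`.InClass` / `.extend F` (the member's piece added to any design polynomial family), C2 `NuDesign.inClass_of_lipOverhang`
(+ `inClass_lipTent`), per-world `familyNuOverhang c' S`
(Verdict: slot + (b)-binders → `NuDict c' θ (bvOverhang θ) S 0 0` ∧ `∀ m ≥ 0, ∀ F, HasMainConstant c' S F m →
HasMainConstant c' S (d.extend F) m` — no lever of either sign) + `_decided` + `rplus_nuOverhang_decided`, the CLOSED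
term `familyNuOverhangAll` + `_decided` + `rplus_nuOverhangAll_decided` + unbundled `not_repairable_nuOverhang`, the
X-world reading `familyNuOverhangAll_record_not_closes` (the dictionary of record never closes; any world where the
extended design had a NEGATIVE main constant would already give Theorem 1, `theorem1_of_negative_mainConstant`);
C3(c′): the DICTIONARY of record `NuDict c' θ (bvOverhang θ) S 0 0` is inhabited by term GIVEN the slot
(`nuDict_zero_of_meanInvisible`) — this describes the dictionary, not the slot: the slot `NuMeanInvisible` itself is
ANALYTIC, its inhabitation is not demanded of this row and is a theorem only on the Lipschitz sub-class (p468144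
`norm_nuPoly_le_of_psiOne`, p470276 `nuMeanInvisible_lipOverhang_frakA`; REF-E verdict 33, correction of
record); load-bearing in the `(M, X)` currency
(`nuCloses_negDiag`: the world `M ≡ −1`, `X = 0` closes on every νψ class) — and HONESTLY NOT exhibitable by term in
the main-constant currency (a νψ piece carrying a negative main constant would be an actual (A)-world asymptotic; none
is typed; said here, not hidden). Part 3 — C4, members of record BY TERM: μψ `lenMuZhang θ` (`g = 1 − z/θ =
ϰ_{θ,0}`, `kappaP_zero_twist`), `lenMuQuad θ` (`(1 − z/θ)²`, `oneSidedProfile_muQuad`), `lenMuPlateau θ`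
(`oneSidedProfile_muPlateau`), in class for `θ > 1` with verdicts at `θ = 5/4, 11/10`; νψ `lenNuPiece θ p` for every
polynomial profile on `[1,θ]` (`bvOverhang_polyProf`: bounded by compactness, variation `≤ Lip·(θ−1)` by the mean
value theorem, zero off `[1,θ]`), the bump `lenNuBump θ` (`bumpPoly`, p467353) and the cut ramp `lenNuRampcut θ`
(`rampPoly θ = (z−1)/(θ−1)`, `rampPoly_eval_five_fourths = 4z − 4`), verdicts at `θ = 5/4, 11/10`. C2:
`rplus_extend` for all four families; no R⁺ sub-case embeds (b, θ > 1 classes; the χψ twins are E-001 / R⁺'s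
two-piece rows) — μψ at `X = 0` with the candidate diagonal is `KnifeEdge.not_muPsiCloses_sqfreeDiagMass`, νψ with no
piece is `F` itself. No numeric certificate is consumed; axioms standard. References: Zhang, arXiv:2211.02515v1, §2
p. 5–6, (2.16), (2.23)–(2.25), Lemma 2.3, Prop. 2.2 (i); §3 (3.5), §4 Lemma 4.2, (4.10); §7 Prop 7.1 (7.2) p.44
[cite: Zhang2022LandauSiegel, §2 (2.16), §4 Lemma 4.2, §7 Prop 7.1 (7.2)]; cell files B-len/KILL-draft.md v2.4 §1/§2/§6,
B-len/designs/INDEX.md, barrier/ASSIGNMENTS.md (S-E-bt2-1), barrier/REF-E.md §0b-v7 / §5b, barrier/p2/MUPSI-X2.md v1.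
ERRATUM v2 (docstring only, no declaration touched; ls-Blen-typer-1 g3): (e1) the νψ table flag now carries the
literal word CONDITIONAL (ls-B-ref-1 21:33:18Z m1; REF-E E-17 «CONDITIONAL on the ANALYTIC slot E-074′»); (e2) the
C3(c′) sentence of Part 2 is corrected per REF-E verdict 33 (it describes the dictionary, not the slot); (e3) the
split of record is final from this file's side: the 12 `len-nu-rampcut-*` JUMP rows stay conditional — no kernel
discharge of `NuMeanInvisible c' θ (bvOverhang θ) S` exists inside the typed skeleton (`KnifeEdge.nuPoly` cuts off at
`⌈P^θ⌉`, so the (4.8) Abel device needs `X₃(y,ψ)` pointwise at `y ≈ P^θ`, while `Skeleton.Ineq35` gives `X₃` only at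
`P²` and in `dx/x`-mean on `[D⁴,P²]`, and `Prop71`/`Lemma81` are typed for `Adm72` supports `n < P/T²` only), the 36
continuous rows are decided in `RepairBlenNuLipschitz` (p470276, `Repair.familyNuLipOverhangAll`).
«The programme SEARCHES and TYPES; no claim about Landau–Siegel zeros, Theorems 1–2 of arXiv:2211.02515 or a repaired
Margin232 until a kernel theorem says so.»
-/

noncomputable section

open Complex Real Set
open _root_.MeasureTheory

namespace Literature.NumberTheory.LFunctions.Zhang2022

namespace Repair

open KnifeEdge Skeleton

/-! ### Part 1 — the μψ row (E-072/E-073; robust price currency) -/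

section MuPsi

variable {b C : ℝ} {M : (ℝ → ℂ) → (ℝ → ℂ) → ℝ} {g g' : ℝ → ℂ}

/-- **The displayed slot of the μψ row (E-072 sign):** the class diagonal functional is `≥ 0` on one-sided profiles
of length `b` (the registry's expectation «a sum of squares»; the binder p458584's `not_robustMuPsiMargin_of_nonneg`
takes inline). Bare predicate, asserted for no `M`. [cite: Zhang2022LandauSiegel, §2 (2.16)] -/
def MuPsiDiagNonneg (b : ℝ) (M : (ℝ → ℂ) → (ℝ → ℂ) → ℝ) : Prop :=
  ∀ g g' : ℝ → ℂ, OneSidedProfile b g g' → 0 ≤ M g g'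

/-- The slot is inhabited by the CANDIDATE diagonal `sqfreeDiagMass b` (`b ≥ 0`; p458584's
`sqfreeDiagMass_nonneg`). [cite: Zhang2022LandauSiegel, §2 p. 5, (2.16)] -/
theorem muPsiDiagNonneg_sqfreeDiagMass (hb : 0 ≤ b) : MuPsiDiagNonneg b (fun g _ => sqfreeDiagMass b g) :=
  fun g _ _ => sqfreeDiagMass_nonneg hb g

/-- … and by the zero functional. [cite: Zhang2022LandauSiegel, §2 (2.16)] -/
theorem muPsiDiagNonneg_zero (b : ℝ) : MuPsiDiagNonneg b (fun _ _ => 0) := fun _ _ _ => le_rfl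

/-- With the sign slot and a price level `C ≥ 0`, the robust-margin value of every one-sided profile of length
`b ≥ 0` is `≥ 0`. [cite: Zhang2022LandauSiegel, §2 (2.16)] -/
theorem muPsi_margin_nonneg (hb : 0 ≤ b) (hC : 0 ≤ C) (hM : MuPsiDiagNonneg b M) (hg : OneSidedProfile b g g') :
    0 ≤ M g g' + C * oneSidedNormSq b g g' :=
  add_nonneg (hM g g' hg) (mul_nonneg hC (oneSidedNormSq_nonneg hb g g'))

/-- **A design of sub-class (L-b)∣μψ:** the top `b` and a one-sided whole profile `g` with marked right derivative
`g′` (coefficients `μ(n)ψ(n)g(z_n)`, `n ≤ P^b`: p458584's `muPsiPoly`). [cite: Zhang2022LandauSiegel, §2 p. 5] -/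
structure MuPsiDesign where
  /-- the logarithmic top `b` (`n ≤ P^b`) -/
  b : ℝ
  /-- the one-sided profile on `[0, b]` -/
  g : ℝ → ℂ
  /-- its marked right derivative -/
  g' : ℝ → ℂ

/-- **Membership in (L-b)∣μψ** (p458584's binder verbatim; NO analytic hypothesis): `b > 1` beyond the wall and
`OneSidedProfile b g g′`. [cite: Zhang2022LandauSiegel, §2 p. 5, §7 (7.2)] -/
structure MuPsiDesign.InClass (d : MuPsiDesign) : Prop where
  one_lt : 1 < d.b
  prof : OneSidedProfile d.b d.g d.g'

/-- **The family «(L-b)∣μψ in the robust world `(C, M)`»**: verdict = at price level `C ≥ 0`, with the displayed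
sign slot `MuPsiDiagNonneg d.b M` (E-072), the member is NOT a robust-margin witness: `¬ (M(g,g′) + C·N_b(g)² < 0)`.
[cite: Zhang2022LandauSiegel, §2 (2.16)] -/
def familyMuPsiOverhang (C : ℝ) (M : (ℝ → ℂ) → (ℝ → ℂ) → ℝ) : DesignFamily where
  Design := MuPsiDesign
  InClass d := d.InClass
  Verdict d := 0 ≤ C → MuPsiDiagNonneg d.b M → ¬ (M d.g d.g' + C * oneSidedNormSq d.b d.g d.g' < 0)

/-- **The μψ family is decided in every robust world.** [cite: Zhang2022LandauSiegel, §2 (2.16)] -/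
theorem familyMuPsiOverhang_decided (C : ℝ) (M : (ℝ → ℂ) → (ℝ → ℂ) → ℝ) : (familyMuPsiOverhang C M).Decided :=
  fun _ hd hC hM => not_lt.2 (muPsi_margin_nonneg (zero_le_one.trans hd.one_lt.le) hC hM hd.prof)

/-- **`R⁺ ++ [(L-b)∣μψ in the world (C, M)]` is decided.** [cite: Zhang2022LandauSiegel, §2 (2.32)–(2.33), (2.16)] -/
theorem rplus_muPsiOverhang_decided (C : ℝ) (M : (ℝ → ℂ) → (ℝ → ℂ) → ℝ) :
    ClassDecided (Rplus ++ [familyMuPsiOverhang C M]) :=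
  rplus_extend (familyMuPsiOverhang_decided C M)

/-- **The CLOSED family «(L-b)∣μψ, all robust worlds»** (the member `blenWord2` appends; worlds `(C, M)` as binders
inside the verdict). [cite: Zhang2022LandauSiegel, §2 (2.16)] -/
def familyMuPsiOverhangAll : DesignFamily where
  Design := MuPsiDesign
  InClass d := d.InClass
  Verdict d := ∀ (C : ℝ) (M : (ℝ → ℂ) → (ℝ → ℂ) → ℝ), 0 ≤ C → MuPsiDiagNonneg d.b M →
    ¬ (M d.g d.g' + C * oneSidedNormSq d.b d.g d.g' < 0)

/-- Same class; the closed verdict is the conjunction over all worlds. [cite: Zhang2022LandauSiegel, §2 (2.16)] -/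
theorem familyMuPsiOverhangAll_iff (d : MuPsiDesign) :
    (familyMuPsiOverhangAll.InClass d ↔
        ∀ (C : ℝ) (M : (ℝ → ℂ) → (ℝ → ℂ) → ℝ), (familyMuPsiOverhang C M).InClass d) ∧
      (familyMuPsiOverhangAll.Verdict d ↔
        ∀ (C : ℝ) (M : (ℝ → ℂ) → (ℝ → ℂ) → ℝ), (familyMuPsiOverhang C M).Verdict d) :=
  ⟨⟨fun h _ _ => h, fun h => h 0 fun _ _ => 0⟩, Iff.rfl⟩

/-- **The closed μψ family is decided.** [cite: Zhang2022LandauSiegel, §2 (2.16)] -/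
theorem familyMuPsiOverhangAll_decided : familyMuPsiOverhangAll.Decided :=
  fun d hd C M hC hM => familyMuPsiOverhang_decided C M d hd hC hM

/-- **`R⁺ ++ [(L-b)∣μψ, all worlds]` is decided.** [cite: Zhang2022LandauSiegel, §2 (2.32)–(2.33), (2.16)] -/
theorem rplus_muPsiOverhangAll_decided : ClassDecided (Rplus ++ [familyMuPsiOverhangAll]) :=
  rplus_extend familyMuPsiOverhangAll_decided

/-- The verdict unbundled. [cite: Zhang2022LandauSiegel, §2 (2.16)] -/
theorem not_repairable_muPsiOverhang (hb : 1 < b) (hC : 0 ≤ C) (hM : MuPsiDiagNonneg b M)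
    (hg : OneSidedProfile b g g') : ¬ (M g g' + C * oneSidedNormSq b g g' < 0) :=
  familyMuPsiOverhangAll_decided ⟨b, g, g'⟩ ⟨hb, hg⟩ C M hC hM

/-- **For the CANDIDATE diagonal the row is DECIDED with no slot:** `sqfreeDiagMass b ≥ 0` is a theorem, so every
member's verdict holds in the world `(C, sqfreeDiagMass)` outright (= p458584's
`not_robustMuPsiMargin_sqfreeDiagMass`, member-wise). [cite: Zhang2022LandauSiegel, §2 p. 5, (2.16)] -/
theorem familyMuPsiOverhangAll_verdict_sqfree {d : MuPsiDesign} (hd : d.InClass) (hC : 0 ≤ C) :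
    ¬ (sqfreeDiagMass d.b d.g + C * oneSidedNormSq d.b d.g d.g' < 0) :=
  familyMuPsiOverhangAll_decided d hd C (fun g _ => sqfreeDiagMass d.b g) hC
    (muPsiDiagNonneg_sqfreeDiagMass (zero_le_one.trans hd.one_lt.le))

/-- **The class-level reading (the stub's verdict sentence):** the closed family is decided IFF in every robust
world beyond the wall with the sign slot there is NO robust margin — `1 < b → 0 ≤ C → MuPsiDiagNonneg b M →
¬ RobustMuPsiMargin b C M`, which is p458584's `not_robustMuPsiMargin_of_nonneg`. [cite: Zhang2022LandauSiegel, §2 (2.16)] -/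
theorem familyMuPsiOverhangAll_decided_iff_not_robustMargin :
    familyMuPsiOverhangAll.Decided ↔
      ∀ (b C : ℝ) (M : (ℝ → ℂ) → (ℝ → ℂ) → ℝ), 1 < b → 0 ≤ C → MuPsiDiagNonneg b M →
        ¬ RobustMuPsiMargin b C M := by
  constructor
  · rintro h b C M hb hC hM ⟨g, g', hg, hlt⟩
    exact h ⟨b, g, g'⟩ ⟨hb, hg⟩ C M hC hM hlt
  · intro h d hd C M hC hM hlt
    exact h d.b C M hd.one_lt hC hM ⟨d.g, d.g', hd.prof, hlt⟩

/-- … in particular no robust margin beyond the wall (= `KnifeEdge.not_robustMuPsiMargin_of_nonneg`, recovered from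
the family). [cite: Zhang2022LandauSiegel, §2 (2.16)] -/
theorem familyMuPsiOverhangAll_not_robustMargin (hb : 1 < b) (hC : 0 ≤ C) (hM : MuPsiDiagNonneg b M) :
    ¬ RobustMuPsiMargin b C M :=
  familyMuPsiOverhangAll_decided_iff_not_robustMargin.1 familyMuPsiOverhangAll_decided b C M hb hC hM

/-- … hence NO ROBUST CLOSING: it is not the case that the class closes against every `C`-bounded off-diagonal
world (T-μψ-2, p465279's `robustMuPsiClosing_iff_robustMargin`). [cite: Zhang2022LandauSiegel, §2 p. 5, (2.16)] -/
theorem familyMuPsiOverhangAll_not_robustClosing (hb : 1 < b) (hC : 0 ≤ C) (hM : MuPsiDiagNonneg b M) :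
    ¬ ∀ X : PairFunctional, OneSidedBounded b C X → MuPsiCloses b M X := fun h =>
  familyMuPsiOverhangAll_not_robustMargin hb hC hM
    ((robustMuPsiClosing_iff_robustMargin (zero_le_one.trans hb.le) hC).1 h)

/-- **Per-top EXACTNESS:** in the world `(C, M)`, every member of top `b > 1` has a non-negative robust-margin value
IFF there is no robust margin at `b` — the verdict's conclusion is the threshold, not a convenience.
[cite: Zhang2022LandauSiegel, §2 (2.16)] -/
theorem muPsi_null_iff_not_robustMargin (hb : 1 < b) (C : ℝ) (M : (ℝ → ℂ) → (ℝ → ℂ) → ℝ) :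
    (∀ d : MuPsiDesign, d.InClass → d.b = b → 0 ≤ M d.g d.g' + C * oneSidedNormSq d.b d.g d.g') ↔
      ¬ RobustMuPsiMargin b C M := by
  constructor
  · rintro h ⟨g, g', hg, hlt⟩
    exact not_lt.2 (h ⟨b, g, g'⟩ ⟨hb, hg⟩ rfl) hlt
  · rintro h d hd rfl
    by_contra hlt
    push Not at hlt
    exact h ⟨d.g, d.g', hd.prof, hlt⟩

/-- **C3(c′) — the sign slot is LOAD-BEARING, by term:** the CONTINUED χψ diagonal `M := Re 𝔅_b`
(`Repair.topDiagForm b`) in the `M`-slot carries a robust margin at price level `C = 0` at every `b > 1` (p465279's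
`muPsiCloses_topDiagForm_zero`, from `Repair.topForm_indefinite` — the θ_max = 1 knife edge).
[cite: Zhang2022LandauSiegel, §7 Prop 7.1 (7.2)] -/
theorem robustMuPsiMargin_topDiagForm (hb : 1 < b) :
    RobustMuPsiMargin b 0 (fun g g' => (topDiagForm b g g').re) := by
  obtain ⟨g, g', hg, h⟩ := muPsiCloses_topDiagForm_zero hb
  refine ⟨g, g', hg, ?_⟩
  simpa using h

/-- … so that world VIOLATES the slot and contains a class member on which the verdict's conclusion FAILS: dropping
`MuPsiDiagNonneg` from the verdict makes it false. [cite: Zhang2022LandauSiegel, §7 Prop 7.1 (7.2)] -/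
theorem muPsiDiag_slot_loadBearing (hb : 1 < b) :
    ¬ MuPsiDiagNonneg b (fun g g' => (topDiagForm b g g').re) ∧
      ∃ d : MuPsiDesign, d.InClass ∧ d.b = b ∧
        (topDiagForm d.b d.g d.g').re + 0 * oneSidedNormSq d.b d.g d.g' < 0 := by
  obtain ⟨g, g', hg, hlt⟩ := robustMuPsiMargin_topDiagForm hb
  refine ⟨fun hM => ?_, ⟨b, g, g'⟩, ⟨hb, hg⟩, rfl, hlt⟩
  exact familyMuPsiOverhangAll_not_robustMargin hb le_rfl hM (robustMuPsiMargin_topDiagForm hb)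

end MuPsi

/-! ### Part 2 — the νψ row (E-074′; invisibility currency) -/

section Nu

/-- **«The design polynomial family `F` has main constant `m` at scale `S`»** (the hypothesis shape of p461177's
`mainTerm_add_nuPiece`, named): under (A), for every `ε > 0`, eventually in `D`,
`|discMean(F) − m·S(D,χ)·𝔓| ≤ ε·S·𝔓`. Bare predicate. [cite: Zhang2022LandauSiegel, §2 (2.16), §7 Prop 7.1 (7.2)] -/
def HasMainConstant (c' : ℝ) (S : Scale) (F : (D : ℕ) → [NeZero D] → DirichletCharacter ℂ D → Chr D → ℂ → ℂ)
    (m : ℝ) : Prop :=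
  ∀ ε : ℝ, 0 < ε → ForAllLarge fun D _ χ => AssumptionA D χ →
    |KnifeEdge.discMean c' χ (F D χ) - m * S D χ * frakP D| ≤ ε * S D χ * frakP D

/-- **A design of sub-class (L-b)∣νψ:** the top `θ` and the ν-PIECE's profile `v` on `[1,θ]` with marked derivative
`v′` (coefficients `ν(n)ψ(n)v(z_n)`, `P < n ≤ P^θ`: p461177's `nuPoly`); the bulk it is glued to is arbitrary (see
`NuDesign.extend`). [cite: Zhang2022LandauSiegel, §3 p. 6, §2 (2.16)] -/
structure NuDesign where
  /-- the logarithmic top `θ` (`n ≤ P^θ`) -/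
  θ : ℝ
  /-- the overhang profile on `[1, θ]` -/
  v : ℝ → ℂ
  /-- its marked right derivative (not read by the class) -/
  v' : ℝ → ℂ

/-- **Membership in (L-b)∣νψ** (the ruling's class verbatim; NO analytic hypothesis): `θ > 1` and
`KnifeEdge.bvOverhang θ v v′` (sup-bounded, bounded variation on `[1,θ]`, zero off `[1,θ]`).
[cite: Zhang2022LandauSiegel, §7 (7.2) p.44] -/
structure NuDesign.InClass (d : NuDesign) : Prop where
  one_lt : 1 < d.θ
  bv : bvOverhang d.θ d.v d.v'

/-- **The member's piece added to an arbitrary design polynomial family `F`** (value tables over the sampled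
pairs). [cite: Zhang2022LandauSiegel, §2 (2.16)] -/
def NuDesign.extend (d : NuDesign) (F : (D : ℕ) → [NeZero D] → DirichletCharacter ℂ D → Chr D → ℂ → ℂ) :
    (D : ℕ) → [NeZero D] → DirichletCharacter ℂ D → Chr D → ℂ → ℂ :=
  fun D _ χ x s => F D χ x s + nuPoly χ x d.v ⌈bigP D ^ d.θ⌉₊ s

/-- **C2 — the Lipschitz sub-class embeds:** a `KnifeEdge.lipOverhang θ` profile (p468144: `K`-Lipschitz, zero off
`[1,θ]`) is a member for `θ > 1` (`KnifeEdge.bvOverhang_of_lipOverhang`); its DECIDED-by-theorem row is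
ls-Blen-typer-2's `familyNuLipOverhangAll` (S-E-bt2-2), this file's conditional row contains it.
[cite: Zhang2022LandauSiegel, §7 (7.2) p.44; §4 (4.8)] -/
theorem NuDesign.inClass_of_lipOverhang {θ : ℝ} {v v' : ℝ → ℂ} (hθ : 1 < θ) (h : lipOverhang θ v v') :
    (⟨θ, v, v'⟩ : NuDesign).InClass :=
  ⟨hθ, bvOverhang_of_lipOverhang hθ.le h⟩

/-- The Lipschitz tent `lipTent θ` (p468144's inhabitant) is thus a member at every `θ > 1`.
[cite: Zhang2022LandauSiegel, §7 (7.2) p.44] -/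
theorem inClass_lipTent {θ : ℝ} (hθ : 1 < θ) : (⟨θ, lipTent θ, fun _ => 0⟩ : NuDesign).InClass :=
  NuDesign.inClass_of_lipOverhang hθ (lipOverhang_lipTent θ)

/-- **The family «(L-b)∣νψ in the world `(c′, S)`»**: verdict = GIVEN the displayed slot `NuMeanInvisible c′ θ
(bvOverhang θ) S` (E-074′, derivation S) and the manuscript's `ScaleEventuallyPos S`, `Prop22i`, `Lemma23 c′` as
binders: (i) the class's dictionary of record at scale `S` is `(M, X) = (0, 0)` (no diagonal, no off-diagonal main
term), and (ii) the member is LEVER-FREE — added to ANY design polynomial family with main constant `m ≥ 0` it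
leaves the main constant `m` (so the extended design closes by positivity iff the original does: neither).
[cite: Zhang2022LandauSiegel, §2 (2.16), §4 Lemma 4.2, (4.10)] -/
def familyNuOverhang (c' : ℝ) (S : Scale) : DesignFamily where
  Design := NuDesign
  InClass d := d.InClass
  Verdict d := NuMeanInvisible c' d.θ (bvOverhang d.θ) S → ScaleEventuallyPos S → Prop22i → Lemma23 c' →
    NuDict c' d.θ (bvOverhang d.θ) S (fun _ _ => 0) 0 ∧
      ∀ m : ℝ, 0 ≤ m → ∀ F : (D : ℕ) → [NeZero D] → DirichletCharacter ℂ D → Chr D → ℂ → ℂ,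
        HasMainConstant c' S F m → HasMainConstant c' S (d.extend F) m

variable {c' : ℝ} {S : Scale}

/-- **The νψ family is decided in every world** (by p461177's `nuDict_zero_of_meanInvisible` and
`mainTerm_add_nuPiece`). [cite: Zhang2022LandauSiegel, §2 (2.16), §4 Lemma 4.2, (4.10)] -/
theorem familyNuOverhang_decided (c' : ℝ) (S : Scale) : (familyNuOverhang c' S).Decided :=
  fun _ hd hInv hS h22 h23 =>
    ⟨nuDict_zero_of_meanInvisible hInv h22 h23,
      fun _ hm _ hF => mainTerm_add_nuPiece hInv hS hm hF hd.bv h22 h23⟩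

/-- **`R⁺ ++ [(L-b)∣νψ in the world (c′, S)]` is decided.** [cite: Zhang2022LandauSiegel, §2 (2.32)–(2.33), (2.16)] -/
theorem rplus_nuOverhang_decided (c' : ℝ) (S : Scale) : ClassDecided (Rplus ++ [familyNuOverhang c' S]) :=
  rplus_extend (familyNuOverhang_decided c' S)

/-- **The CLOSED family «(L-b)∣νψ, all worlds»** (the member `blenWord2` appends; `(c′, S)` as binders inside the
verdict). [cite: Zhang2022LandauSiegel, §2 (2.16), §4 Lemma 4.2] -/
def familyNuOverhangAll : DesignFamily where
  Design := NuDesign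
  InClass d := d.InClass
  Verdict d := ∀ (c' : ℝ) (S : Scale), NuMeanInvisible c' d.θ (bvOverhang d.θ) S → ScaleEventuallyPos S →
    Prop22i → Lemma23 c' →
      NuDict c' d.θ (bvOverhang d.θ) S (fun _ _ => 0) 0 ∧
        ∀ m : ℝ, 0 ≤ m → ∀ F : (D : ℕ) → [NeZero D] → DirichletCharacter ℂ D → Chr D → ℂ → ℂ,
          HasMainConstant c' S F m → HasMainConstant c' S (d.extend F) m

/-- Same class; the closed verdict is the conjunction over all worlds. [cite: Zhang2022LandauSiegel, §2 (2.16)] -/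
theorem familyNuOverhangAll_iff (d : NuDesign) :
    (familyNuOverhangAll.InClass d ↔ ∀ (c' : ℝ) (S : Scale), (familyNuOverhang c' S).InClass d) ∧
      (familyNuOverhangAll.Verdict d ↔ ∀ (c' : ℝ) (S : Scale), (familyNuOverhang c' S).Verdict d) :=
  ⟨⟨fun h _ _ => h, fun h => h 0 frakAScale⟩, Iff.rfl⟩

/-- **The closed νψ family is decided.** [cite: Zhang2022LandauSiegel, §2 (2.16), §4 Lemma 4.2, (4.10)] -/
theorem familyNuOverhangAll_decided : familyNuOverhangAll.Decided :=
  fun d hd c' S => familyNuOverhang_decided c' S d hd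

/-- **`R⁺ ++ [(L-b)∣νψ, all worlds]` is decided.** [cite: Zhang2022LandauSiegel, §2 (2.32)–(2.33), (2.16)] -/
theorem rplus_nuOverhangAll_decided : ClassDecided (Rplus ++ [familyNuOverhangAll]) :=
  rplus_extend familyNuOverhangAll_decided

/-- The verdict unbundled (every hypothesis a binder). [cite: Zhang2022LandauSiegel, §2 (2.16), §4 Lemma 4.2] -/
theorem not_repairable_nuOverhang {θ : ℝ} {v v' : ℝ → ℂ} (hθ : 1 < θ) (hv : bvOverhang θ v v')
    (hInv : NuMeanInvisible c' θ (bvOverhang θ) S) (hS : ScaleEventuallyPos S) (h22 : Prop22i) (h23 : Lemma23 c')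
    {m : ℝ} (hm : 0 ≤ m) {F : (D : ℕ) → [NeZero D] → DirichletCharacter ℂ D → Chr D → ℂ → ℂ}
    (hF : HasMainConstant c' S F m) : HasMainConstant c' S ((⟨θ, v, v'⟩ : NuDesign).extend F) m :=
  (familyNuOverhangAll_decided ⟨θ, v, v'⟩ ⟨hθ, hv⟩ c' S hInv hS h22 h23).2 m hm F hF

/-- **The X-world reading: the dictionary of record never closes** (`(M, X) = (0, 0)`; p461177's
`not_nuCloses_of_record` — trivially, of either sign), and it IS the dictionary given the slot.
[cite: Zhang2022LandauSiegel, §2 (2.16), §4 Lemma 4.2] -/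
theorem familyNuOverhangAll_record_not_closes {θ : ℝ} (hInv : NuMeanInvisible c' θ (bvOverhang θ) S)
    (h22 : Prop22i) (h23 : Lemma23 c') :
    NuDict c' θ (bvOverhang θ) S (fun _ _ => 0) 0 ∧ ¬ NuCloses (bvOverhang θ) (fun _ _ => 0) 0 :=
  not_nuCloses_of_invisible hInv h22 h23

/-- **What a closing νψ world would be:** a design polynomial family with a NEGATIVE main constant at an eventually
positive scale already gives Theorem 1 of the manuscript (positivity endgame, p458584's
`eventually_not_assumptionA_of_negative_mainTerm_scale`) — so no such world can be exhibited by term short of that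
theorem; with the slot, the extended designs of the class have main constant `m ≥ 0` instead.
[cite: Zhang2022LandauSiegel, §2 p. 6, (2.16), Lemma 2.3, Prop. 2.2 (i)] -/
theorem theorem1_of_negative_mainConstant {m : ℝ} (hm : m < 0) (hS : ScaleEventuallyPos S)
    {F : (D : ℕ) → [NeZero D] → DirichletCharacter ℂ D → Chr D → ℂ → ℂ} (hF : HasMainConstant c' S F m)
    (h22 : Prop22i) (h23 : Lemma23 c') : Theorem1 :=
  Skeleton.theorem1_of_eventually_not_assumptionA
    (eventually_not_assumptionA_of_negative_mainTerm_scale hm hS hF h22 h23)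

/-- **C3(c′) — inhabited and load-bearing, honestly.** In the `(M, X)` currency of `NuCloses` the world `M ≡ −1`,
`X = 0` closes on EVERY νψ class at every top (the zero profile is a member, `bvOverhang_zero`): without the
invisibility-forced record `(0,0)` the «no» is false — the slot is load-bearing there. In the main-constant currency a
closing world is NOT exhibitable by term (`theorem1_of_negative_mainConstant`); said, not hidden.
[cite: Zhang2022LandauSiegel, §2 (2.16)] -/
theorem nuCloses_negDiag (θ : ℝ) : NuCloses (bvOverhang θ) (fun _ _ => -1) 0 :=
  ⟨fun _ => 0, fun _ => 0, bvOverhang_zero θ, by norm_num⟩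

end Nu

/-! ### Part 3 — C4: the members of record as data -/

section MembersMu

variable {θ : ℝ}

/-- Zhang's own one-sided mollifier profile `1 − z/θ` is `ϰ_{θ,0}` (twist `k = 0`).
[cite: Zhang2022LandauSiegel, §2 p. 5, (2.23)–(2.25)] -/
theorem kappaP_zero_twist (θ z : ℝ) : kappaP θ 0 z = if z ≤ θ then (((1 - z / θ : ℝ)) : ℂ) else 0 := by
  unfold kappaP
  split_ifs <;> simp

/-- **Member of record `len-mu-zhang-th{θ}`:** `g(z) = 1 − z/θ` on `[0, θ]` (BATCH-2 coefficient list `[1, −1/θ]`).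
[cite: Zhang2022LandauSiegel, §2 p. 5, (2.23)–(2.25)] -/
def lenMuZhang (θ : ℝ) : MuPsiDesign := ⟨θ, kappaP θ 0, kappaP' θ 0⟩

/-- in class for every `θ > 1` (`KnifeEdge.oneSidedProfile_kappaP`). [cite: Zhang2022LandauSiegel, (2.23)–(2.25)] -/
theorem inClass_lenMuZhang (hθ : 1 < θ) : (lenMuZhang θ).InClass :=
  ⟨hθ, oneSidedProfile_kappaP (zero_lt_one.trans hθ)⟩

/-- the square profile `(1 − z/θ)²` (BATCH-2 shape «quad», coefficient list `[1, −2/θ, 1/θ²]`), as a global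
polynomial (only `[0, θ]` is read). [cite: Zhang2022LandauSiegel, §2 p. 5] -/
def muQuad (θ : ℝ) (z : ℝ) : ℂ := ((((1 - z / θ) ^ 2 : ℝ)) : ℂ)

/-- its derivative `−(2/θ)(1 − z/θ)`. [cite: Zhang2022LandauSiegel, §2 p. 5] -/
def muQuad' (θ : ℝ) (z : ℝ) : ℂ := ((((-2 / θ) * (1 - z / θ) : ℝ)) : ℂ)

/-- `(1 − z/θ)²` is a one-sided profile of length `θ`, `θ ≠ 0`. [cite: Zhang2022LandauSiegel, §2 p. 5, §7 (7.2)] -/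
theorem oneSidedProfile_muQuad (hθ : θ ≠ 0) : OneSidedProfile θ (muQuad θ) (muQuad' θ) where
  cont := by
    have : Continuous (muQuad θ) := by unfold muQuad; fun_prop
    exact this.continuousOn
  hasDeriv := by
    intro x _
    have h1 : HasDerivAt (fun z : ℝ => (1 - z / θ) ^ 2) (2 * (1 - x / θ) ^ 1 * (-(1 / θ))) x := by
      have hlin : HasDerivAt (fun z : ℝ => 1 - z / θ) (-(1 / θ)) x := by
        simpa using ((hasDerivAt_id x).div_const θ).const_sub 1
      exact hlin.pow 2
    have h2 : HasDerivAt (muQuad θ) (muQuad' θ x) x := by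
      have := h1.ofReal_comp
      refine this.congr_deriv ?_
      simp [muQuad']
      ring
    exact h2.hasDerivWithinAt
  top := by simp [muQuad, div_self hθ]

/-- **Member of record `len-mu-quad-th{θ}`:** `g(z) = (1 − z/θ)²`. [cite: Zhang2022LandauSiegel, §2 p. 5] -/
def lenMuQuad (θ : ℝ) : MuPsiDesign := ⟨θ, muQuad θ, muQuad' θ⟩

/-- in class for every `θ > 1`. [cite: Zhang2022LandauSiegel, §2 p. 5, §7 (7.2)] -/
theorem inClass_lenMuQuad (hθ : 1 < θ) : (lenMuQuad θ).InClass :=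
  ⟨hθ, oneSidedProfile_muQuad (zero_lt_one.trans hθ).ne'⟩

/-- the plateau profile: `1` on `[0,1]`, `(θ − z)/(θ − 1)` on `[1, θ]`, `0` beyond (BATCH-2 shape «plateau»;
continuous, a KINK at the wall, wall value `1`). [cite: Zhang2022LandauSiegel, §2 p. 5] -/
def muPlateau (θ : ℝ) (z : ℝ) : ℂ := (((min 1 (max ((θ - z) / (θ - 1)) 0) : ℝ)) : ℂ)

/-- its marked right derivative: `0` below the wall, `−1/(θ−1)` on `[1, θ)`, `0` beyond.
[cite: Zhang2022LandauSiegel, §2 p. 5] -/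
def muPlateau' (θ : ℝ) (z : ℝ) : ℂ := if z < 1 then 0 else if z < θ then ((((-1) / (θ - 1) : ℝ)) : ℂ) else 0

/-- The plateau is a one-sided profile of length `θ` for `θ > 1` (right derivatives at the kink `z = 1` included).
[cite: Zhang2022LandauSiegel, §2 p. 5, §7 (7.2)] -/
theorem oneSidedProfile_muPlateau (hθ : 1 < θ) : OneSidedProfile θ (muPlateau θ) (muPlateau' θ) where
  cont := by
    have : Continuous (muPlateau θ) := by unfold muPlateau; fun_prop
    exact this.continuousOn
  hasDeriv := by
    intro x hx
    have hθ1 : 0 < θ - 1 := by linarith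
    by_cases hx1 : x < 1
    · -- below the wall the profile is locally the constant `1`
      have heq : ∀ᶠ z in nhds x, muPlateau θ z = 1 := by
        filter_upwards [Iio_mem_nhds hx1] with z hz
        have hz' : 1 ≤ (θ - z) / (θ - 1) := by
          rw [le_div_iff₀ hθ1]; linarith [mem_Iio.1 hz]
        simp [muPlateau, min_eq_left (le_max_of_le_left hz')]
      have hd : HasDerivAt (muPlateau θ) 0 x :=
        (hasDerivAt_const x (1:ℂ)).congr_of_eventuallyEq heq
      simpa [muPlateau', hx1] using hd.hasDerivWithinAt (s := Ioi x)
    · -- on `[1, θ)` the profile is `(θ − z)/(θ − 1)` to the RIGHT of `x`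
      push Not at hx1
      have hxθ : x < θ := hx.2
      have hlin : HasDerivAt (fun z : ℝ => ((((θ - z) / (θ - 1) : ℝ)) : ℂ)) ((((-1) / (θ - 1) : ℝ)) : ℂ) x := by
        have h1 : HasDerivAt (fun z : ℝ => (θ - z) / (θ - 1)) ((-1) / (θ - 1)) x := by
          simpa using ((hasDerivAt_id x).const_sub θ).div_const (θ - 1)
        exact h1.ofReal_comp
      have heq : ∀ᶠ z in nhdsWithin x (Ioi x), muPlateau θ z = ((((θ - z) / (θ - 1) : ℝ)) : ℂ) := by
        have hmem : Ioo x θ ∈ nhdsWithin x (Ioi x) := Ioo_mem_nhdsGT hxθ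
        filter_upwards [hmem] with z hz
        have hzq0 : 0 ≤ (θ - z) / (θ - 1) := div_nonneg (by linarith [hz.2]) hθ1.le
        have hzq1 : (θ - z) / (θ - 1) ≤ 1 := by rw [div_le_one hθ1]; linarith [hz.1]
        simp [muPlateau, max_eq_left hzq0, min_eq_right hzq1]
      have hxval : muPlateau θ x = ((((θ - x) / (θ - 1) : ℝ)) : ℂ) := by
        have hq0 : 0 ≤ (θ - x) / (θ - 1) := div_nonneg (by linarith) hθ1.le
        have hq1 : (θ - x) / (θ - 1) ≤ 1 := by rw [div_le_one hθ1]; linarith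
        simp [muPlateau, max_eq_left hq0, min_eq_right hq1]
      have hd : HasDerivWithinAt (muPlateau θ) ((((-1) / (θ - 1) : ℝ)) : ℂ) (Ioi x) x :=
        hlin.hasDerivWithinAt.congr_of_eventuallyEq heq hxval
      simpa [muPlateau', not_lt.2 hx1, hxθ] using hd
  top := by
    have hθ1 : 0 < θ - 1 := by linarith
    simp [muPlateau]

/-- **Member of record `len-mu-plateau-th{θ}`.** [cite: Zhang2022LandauSiegel, §2 p. 5] -/
def lenMuPlateau (θ : ℝ) : MuPsiDesign := ⟨θ, muPlateau θ, muPlateau' θ⟩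

/-- in class for every `θ > 1`. [cite: Zhang2022LandauSiegel, §2 p. 5, §7 (7.2)] -/
theorem inClass_lenMuPlateau (hθ : 1 < θ) : (lenMuPlateau θ).InClass := ⟨hθ, oneSidedProfile_muPlateau hθ⟩

/-- **C4 — verdicts of the μψ members of record** at the knots `θ = 5/4` and `11/10` (the companions and `21/20`
alike, `θ > 1` by `norm_num`). [cite: Zhang2022LandauSiegel, §2 (2.16)] -/
theorem verdict_lenMu :
    familyMuPsiOverhangAll.Verdict (lenMuZhang (5/4)) ∧ familyMuPsiOverhangAll.Verdict (lenMuQuad (5/4)) ∧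
      familyMuPsiOverhangAll.Verdict (lenMuPlateau (5/4)) ∧ familyMuPsiOverhangAll.Verdict (lenMuZhang (11/10)) ∧
        familyMuPsiOverhangAll.Verdict (lenMuQuad (11/10)) ∧ familyMuPsiOverhangAll.Verdict (lenMuPlateau (11/10)) :=
  ⟨familyMuPsiOverhangAll_decided _ (inClass_lenMuZhang (by norm_num)),
    familyMuPsiOverhangAll_decided _ (inClass_lenMuQuad (by norm_num)),
    familyMuPsiOverhangAll_decided _ (inClass_lenMuPlateau (by norm_num)),
    familyMuPsiOverhangAll_decided _ (inClass_lenMuZhang (by norm_num)),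
    familyMuPsiOverhangAll_decided _ (inClass_lenMuQuad (by norm_num)),
    familyMuPsiOverhangAll_decided _ (inClass_lenMuPlateau (by norm_num))⟩

end MembersMu

section MembersNu

variable {θ : ℝ}

/-- **Every polynomial profile on `[1, θ]` (zero elsewhere; `Repair.polyProf`, p467353) is a νψ class profile for
`θ > 1`:** sup-bounded by compactness, of variation `≤ Lip·(θ − 1)` on `[1,θ]` by the mean value theorem
(`Convex.lipschitzOnWith_of_nnnorm_hasDerivWithin_le` + `LipschitzOnWith.comp_eVariationOn_le` against the monotone
identity), zero off `[1,θ]` by definition — the C4 membership of all 48 `len-nu-*` rows at once.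
[cite: Zhang2022LandauSiegel, §7 (7.2) p.44] -/
theorem bvOverhang_polyProf (hθ : 1 < θ) (p : Polynomial ℝ) : bvOverhang θ (polyProf θ p) (polyProf' θ p) := by
  have hθ1 : 0 ≤ θ - 1 := by linarith
  -- sup bound (from the Λ-file's overhang structure of the same profile)
  obtain ⟨B, hB⟩ := (overhang_polyPiece hθ (le_refl 1) p).bdd
  have hB0 : 0 ≤ B := (norm_nonneg _).trans (hB 0)
  -- a Lipschitz constant on `[1, θ]` from a bound on `p′`
  have hcont' : Continuous fun z : ℝ => (((Polynomial.derivative p).eval z : ℝ) : ℂ) :=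
    Complex.continuous_ofReal.comp (Polynomial.derivative p).continuous
  obtain ⟨B', hB'⟩ := (isCompact_Icc (a := (1:ℝ)) (b := θ)).exists_bound_of_continuousOn hcont'.continuousOn
  have hderiv : ∀ x ∈ Icc (1:ℝ) θ, HasDerivWithinAt (polyProf θ p)
      ((((Polynomial.derivative p).eval x : ℝ)) : ℂ) (Icc 1 θ) x := by
    intro x hx
    have hd : HasDerivAt (fun z : ℝ => ((p.eval z : ℝ) : ℂ)) ((((Polynomial.derivative p).eval x : ℝ)) : ℂ) x :=
      (p.hasDerivAt x).ofReal_comp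
    refine hd.hasDerivWithinAt.congr (fun z hz => ?_) ?_
    · simp [polyProf, hz.1, hz.2]
    · simp [polyProf, hx.1, hx.2]
  have hlip : LipschitzOnWith (Real.toNNReal B') (polyProf θ p) (Icc 1 θ) := by
    refine (convex_Icc (1:ℝ) θ).lipschitzOnWith_of_nnnorm_hasDerivWithin_le hderiv fun x hx => ?_
    rw [← NNReal.coe_le_coe, coe_nnnorm, Real.coe_toNNReal']
    exact (hB' x hx).trans (le_max_left _ _)
  -- variation on `[1, θ]`
  have hvar : eVariationOn (polyProf θ p) (Icc 1 θ) ≤ ENNReal.ofReal (max B' 0 * (θ - 1)) := by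
    have h1 : eVariationOn (polyProf θ p ∘ id) (Icc 1 θ) ≤ (Real.toNNReal B' : ENNReal) * eVariationOn id (Icc 1 θ) :=
      hlip.comp_eVariationOn_le (mapsTo_id _)
    have h2 : eVariationOn (id : ℝ → ℝ) (Icc 1 θ) ≤ ENNReal.ofReal (θ - 1) := by
      have := (monotone_id.monotoneOn (Icc (1:ℝ) θ)).eVariationOn_le (left_mem_Icc.2 hθ.le) (right_mem_Icc.2 hθ.le)
      rwa [Set.inter_self] at this
    calc eVariationOn (polyProf θ p) (Icc 1 θ)
        = eVariationOn (polyProf θ p ∘ id) (Icc 1 θ) := rfl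
      _ ≤ (Real.toNNReal B' : ENNReal) * eVariationOn id (Icc 1 θ) := h1
      _ ≤ (Real.toNNReal B' : ENNReal) * ENNReal.ofReal (θ - 1) := by gcongr
      _ = ENNReal.ofReal (max B' 0 * (θ - 1)) := by
          rw [ENNReal.ofReal_mul (le_max_right _ _), ← Real.coe_toNNReal', ENNReal.ofReal_coe_nnreal]
  refine ⟨⟨B, max B' 0 * (θ - 1), hB0, mul_nonneg (le_max_right _ _) hθ1, ?_, hvar⟩, fun z hz => ?_⟩
  · intro z
    simpa [polyPiece] using hB z
  · rcases hz with hz | hz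
    · simp [polyProf, not_le.2 hz]
    · simp [polyProf, not_le.2 hz]

/-- **The νψ member with a polynomial profile on `[1,θ]`** (the `len-nu-*` row shape; the bulk is not part of the
design). [cite: Zhang2022LandauSiegel, §7 (7.2) p.44] -/
def lenNuPiece (θ : ℝ) (p : Polynomial ℝ) : NuDesign := ⟨θ, polyProf θ p, polyProf' θ p⟩

/-- in class for every `θ > 1`. [cite: Zhang2022LandauSiegel, §7 (7.2) p.44] -/
theorem inClass_lenNuPiece (hθ : 1 < θ) (p : Polynomial ℝ) : (lenNuPiece θ p).InClass :=
  ⟨hθ, bvOverhang_polyProf hθ p⟩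

/-- **Member of record `len-nu-bump-u{52,32}-th{θ}`** (its piece): the bump `4t(1−t)` of p467353's `bumpPoly`.
[cite: Zhang2022LandauSiegel, §7 (7.2) p.44] -/
def lenNuBump (θ : ℝ) : NuDesign := lenNuPiece θ (bumpPoly θ)

/-- the cut ramp `t = (z − 1)/(θ − 1)` on `[1,θ]` with its JUMP at `θ` (BATCH-1v2 shape «rampcut»; at `θ = 5/4` the
coefficient list `[−4, 4]`, jump `1 → 0` at `5/4`). [cite: Zhang2022LandauSiegel, §7 (7.2) p.44] -/
def rampPoly (θ : ℝ) : Polynomial ℝ := Polynomial.C (1 / (θ - 1)) * (Polynomial.X - Polynomial.C 1)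

/-- the ramp's values. [cite: Zhang2022LandauSiegel, §7 (7.2) p.44] -/
theorem rampPoly_eval (θ z : ℝ) : (rampPoly θ).eval z = 1 / (θ - 1) * (z - 1) := by
  simp [rampPoly]

/-- at `θ = 5/4` the ramp is `4z − 4` (the design file's coefficient list `[−4, 4]`).
[cite: Zhang2022LandauSiegel, §7 (7.2) p.44] -/
theorem rampPoly_eval_five_fourths (z : ℝ) : (rampPoly (5/4)).eval z = -4 + 4 * z := by
  rw [rampPoly_eval]
  norm_num
  ring

/-- **Member of record `len-nu-rampcut-u{52,32}-th{θ}`** (its piece). [cite: Zhang2022LandauSiegel, §7 (7.2) p.44] -/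
def lenNuRampcut (θ : ℝ) : NuDesign := lenNuPiece θ (rampPoly θ)

/-- **C4 — verdicts of the νψ members of record** at the knots `θ = 5/4` and `11/10`.
[cite: Zhang2022LandauSiegel, §2 (2.16), §4 Lemma 4.2] -/
theorem verdict_lenNu :
    familyNuOverhangAll.Verdict (lenNuBump (5/4)) ∧ familyNuOverhangAll.Verdict (lenNuRampcut (5/4)) ∧
      familyNuOverhangAll.Verdict (lenNuBump (11/10)) ∧ familyNuOverhangAll.Verdict (lenNuRampcut (11/10)) :=
  ⟨familyNuOverhangAll_decided _ (inClass_lenNuPiece (by norm_num) _),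
    familyNuOverhangAll_decided _ (inClass_lenNuPiece (by norm_num) _),
    familyNuOverhangAll_decided _ (inClass_lenNuPiece (by norm_num) _),
    familyNuOverhangAll_decided _ (inClass_lenNuPiece (by norm_num) _)⟩

end MembersNu

end Repair

end Literature.NumberTheory.LFunctions.Zhang2022
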